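import Literature.NumberTheory.GaloisRepresentations.LatticePermutationCover
import Literature.NumberTheory.GaloisRepresentations.HomDualPushforwardVanishing
import Literature.NumberTheory.GaloisRepresentations.IdeleExtensionLocalGlobal
import Literature.NumberTheory.GaloisRepresentations.HomDualShaTwoExhaustion
import HarnessLib

/-!
# The idèle-torus Hasse principle, covariant native form: a locally trivial class of `H¹(K, Hom_ℤ(X, K̄ˣ))` dies in
# `H¹(K, Hom_ℤ(X, J̄))` for every lattice `X` of `C_Γ` trivialised by a layer — `Ш¹(K, T) ⊆ Ker(H¹(K, T(K̄)) → H¹(K, T(𝔸_K̄)))`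
# (input (B) of property (e) of the NATIVE `Ш²`-obstruction road to Milne *ADT* I Thm. 4.10 (a))

Topic `NumberTheory/GaloisRepresentations`; namespace `Literature.NumberTheory.GaloisRepresentations.IdeleReadout`.
One definition with body (`unitsHomOfInvariant`: an equivariant `X → K̄ˣ` as a `C_Γ`-morphism `X ⟶ F̄ˣ = lim→ Eˣ`) and
theorems; no named fact, no instance, no notation, no `sorry`; number fields in `Type`.
Assembles this seat's `LatticePermutationCover` (the cover `0 → X₂ → ℤ[Γ/U_E]ᵏ → X → 0`, `H¹(K, Hom(ℤ[Γ/U_E]ᵏ, K̄ˣ)) = 0`),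
`IdeleExtensionLocalGlobal` (**`exists_comp_eq_unitsToIdele_of_localExtensions`**: local extendability at every place ⟹
global extendability into `J̄`) and `HomDualPushforwardVanishing` (`map_postcomp_dualδ₀_eq_zero_of_extends'`: the pushed
`δ₀`-class is a coboundary once `j ∘ w` extends), in the currency of cell bsd-wall's NATIVE obstruction map
(`HomDualShaTwoConnecting`, chl-p2 g7: `unitsToIdeleI K : K̄ˣ → J̄`, `homInvariant`, `homOfEquivariant`,
`hom_idele_isSES`) and door-c6's `dualδ₀` / `map_res_dualδ₀_eq`.

THE MATHEMATICS.  `K` a number field, `X` an object of door-c4's `C_Γ` of finite type over `ℤ` on which a layer `U_E`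
acts trivially (a LATTICE: e.g. the relation module `N₁ = (presentationComplex ρ).X₁`), `T_X = Hom_ℤ(X, 𝔾_m)` the torus it
splits.  A class `y ∈ H¹(K, Hom_ℤ(X, K̄ˣ)) = H¹(K, T_X)` is **locally trivial** when for every place `v` its restriction
to `Γ_{K_v}` pushed along `K̄ˣ → K̄_vˣ` vanishes in `H¹(K_v, Hom_ℤ(X, K̄_vˣ))` (door-c6's currency
`galoisCohomology.map (postcompRes … (unitsTransfer K K_v)) 1 (galoisCohomology.res … K_v 1 y) = 0`).  THEN
**`H¹(j_*) y = 0` in `H¹(K, Hom_ℤ(X, J̄))`**, `j = unitsToIdeleI K : K̄ˣ → J̄` the principal idèles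
(`map_postcomp_unitsToIdeleI_eq_zero_of_locallyTrivial`).  Proof: by the cover and `H¹(K, Hom(ℤ[Γ/U_E]ᵏ, K̄ˣ)) = 0`,
`y = δ₀ w` for an equivariant `w : X₂ → K̄ˣ` (door-c6 `dualδ₀_surjective`), i.e. `w = ι ∘ u₀` for a `C_Γ`-morphism
`u₀ : X₂ ⟶ F̄ˣ` (`unitsHomOfInvariant`); local triviality says `ι_v ∘ u₀` extends `Γ_{K_v}`-equivariantly to `ℤ[Γ/U_E]ᵏ`
at every place (`map_res_dualδ₀_eq`, `dualδ₀_eq_zero_iff`), so `u₀ ≫ (F̄ˣ → J̄)` extends to `e : ℤ[Γ/U_E]ᵏ ⟶ J̄`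
(`exists_comp_eq_unitsToIdele_of_localExtensions`: unit correction + door-c5's idèle assembly + uniqueness), and then
`H¹(j_*)(δ₀ w)` is the class of a coboundary (`map_postcomp_dualδ₀_eq_zero_of_extends'`).  Consequently
(**`exists_hom_δ₀_eq_of_locallyTrivial`**, covariant exactness of chl-p2's `Hom(N₁, T)`): for the relation lattice `N₁`
of the canonical presentation of a finite module `ρ`, a locally trivial `y ∈ H¹(K, Hom_ℤ(N₁, K̄ˣ))` is `δ₀^{Hom(N₁,T)}(h)` for a
`C_Γ`-morphism `h : N₁ ⟶ C̄` — the input "(B)" of property (e) `Ш²(K, M^D) ⊆ Im Ψ` for the native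
`Ψ = HomDual.shaTwoConnecting ρ n hM`; the other input "(A)" is Brauer–Hasse–Noether for `Hom_ℤ(ℤ[Γ/U_{K(M)}]^{|M|}, K̄ˣ)`.
HONEST FRAMING: no case of Poitou–Tate or BSD is proved here.

## References
* J. S. Milne, *Arithmetic Duality Theorems* (2nd ed. 2006), I Lemma 4.13, proof of Thm. 4.10 (a) (p. 58). [MilneADT2006]
* J. Neukirch, A. Schmidt, K. Wingberg, *Cohomology of Number Fields* (2008), (1.3.2). [NeukirchSchmidtWingberg2008]
* J. W. S. Cassels, A. Fröhlich (eds.), *Algebraic Number Theory* (1967), Ch. VII (Tate) §8 Prop. 8.1, §9.7.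
  [CasselsFrohlichANT1967]
-/

noncomputable section

open NumberField NumberField.InfinitePlace IsDedekindDomain Field CategoryTheory
open Literature.NumberTheory.Automorphic

namespace Literature.NumberTheory.GaloisRepresentations

namespace IdeleReadout

open SemiLocal ArchHerbrand DiscreteGaloisModule IdeleCohomology IdeleClassBar HomDual DGMBridge FreePresentation
  Literature.Algebra.Homology Literature.Algebra.Homology.DiscreteRep

variable {K : Type} [Field K] [NumberField K]

/-! ## §1 An equivariant `X → K̄ˣ` (invariant of `Hom_ℤ(X, K̄ˣ)`) as a `C_Γ`-morphism `X ⟶ F̄ˣ = lim→ Eˣ` -/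

section UnitsHom

variable (Y : DiscreteRepCat ℤ (absoluteGaloisGroup K)) [Module.Finite ℤ (LCarrier Y)]

/-- **The `C_Γ`-morphism `Y ⟶ F̄ˣ` of an invariant `w ∈ Hom_ℤ(Y, K̄ˣ)^{Γ_K}`** (`x ↦ unitsBarAddEquiv⁻¹ (w x)`, through
chl-p2's `homOfEquivariant`; inverse of door-c6's `unitsInvariant`). [cite: SerreGaloisCohomology1997, II §1.1] -/
def unitsHomOfInvariant (w : (homGaloisModule (toDGM Y) (units K)).toTopRep.ρ.invariants) : Y ⟶ unitsBarD K :=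
  homOfEquivariant Y (unitsBarD K)
    ((LCarrier.of (unitsBarD K)).comp (((unitsBarAddEquiv K).symm : UnitsCarrier K →+ (unitsData K).toSystem.limit).comp
      (show LCarrier Y →ₗ[ℤ] UnitsCarrier K from (w.1 : DiscreteRep.HomCarrier (LCarrier Y) (UnitsCarrier K))).toAddMonoidHom))
    fun σ x => by
      have hw := (mem_invariants_iff (toDGM Y) (units K) w.1).1 w.2 σ x
      change LCarrier.of (unitsBarD K) ((unitsBarAddEquiv K).symm
        ((show LCarrier Y →ₗ[ℤ] UnitsCarrier K from (w.1 : DiscreteRep.HomCarrier (LCarrier Y) (UnitsCarrier K)))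
          (toDGM Y σ x))) =
        LCarrier.of (unitsBarD K) ((unitsBarD K).obj.ρ σ (LCarrier.val (unitsBarD K) (LCarrier.of (unitsBarD K)
          ((unitsBarAddEquiv K).symm ((show LCarrier Y →ₗ[ℤ] UnitsCarrier K from
            (w.1 : DiscreteRep.HomCarrier (LCarrier Y) (UnitsCarrier K))) x)))))
      rw [hw, LCarrier.val_of]
      refine congrArg (LCarrier.of (unitsBarD K)) ((unitsBarAddEquiv K).injective ?_)
      change unitsBarAddEquiv K ((unitsBarAddEquiv K).symm (units K σ _)) =
        unitsBarAddEquiv K ((unitsData K).toSystem.rep σ ((unitsBarAddEquiv K).symm _))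
      rw [AddEquiv.apply_symm_apply, unitsBarAddEquiv_rep, AddEquiv.apply_symm_apply]

/-- **`unitsInvariant (unitsHomOfInvariant w) = w`.** [cite: SerreGaloisCohomology1997, II §1.1] -/
@[simp] theorem unitsInvariant_unitsHomOfInvariant (w : (homGaloisModule (toDGM Y) (units K)).toTopRep.ρ.invariants) :
    unitsInvariant Y (unitsHomOfInvariant Y w) = w := by
  refine Subtype.ext (LinearMap.ext fun x => ?_)
  rw [coe_unitsInvariant, unitsMap_apply, unitsHomOfInvariant, homOfEquivariant_hom_apply]
  change unitsBarAddEquiv K ((unitsBarAddEquiv K).symm ((show LCarrier Y →ₗ[ℤ] UnitsCarrier K from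
    (w.1 : DiscreteRep.HomCarrier (LCarrier Y) (UnitsCarrier K))) (LCarrier.of Y (LCarrier.val Y x)))) = _
  rw [AddEquiv.apply_symm_apply]
  rfl

end UnitsHom

/-! ## §2 `Ш¹(K, Hom_ℤ(X, K̄ˣ))` dies in `H¹(K, Hom_ℤ(X, J̄))` -/

section Main

variable (E : GalLayer K) (X : DiscreteRepCat ℤ (absoluteGaloisGroup K)) [Module.Finite ℤ (LCarrier X)]
  (hX : ∀ σ ∈ E.openNormalSubgroup, ∀ x : X.obj.V, X.obj.ρ σ x = x)

include hX in
/-- **The idèle-torus Hasse principle, covariant native form.**  For a finite-type object `X` of `C_Γ` trivialised by a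
layer and `y ∈ H¹(K, Hom_ℤ(X, K̄ˣ))` whose restriction to every `Γ_{K_v}`, pushed along `K̄ˣ → K̄_vˣ`, vanishes:
`H¹(j_*) y = 0` in `H¹(K, Hom_ℤ(X, J̄))` for the principal idèles `j = unitsToIdeleI K`.
[cite: MilneADT2006, I Lemma 4.13, I Theorem 4.10 (proof, p. 58)] [cite: NeukirchSchmidtWingberg2008, (1.3.2)] -/
theorem map_postcomp_unitsToIdeleI_eq_zero_of_locallyTrivial
    (y : galoisCohomology (homGaloisModule (toDGM X) (units K)) 1)
    (hloc : ∀ v : Place K,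
      galoisCohomology.map (postcompRes (toDGM X) (units K) (units (Place.Completion v)) (unitsTransfer K (Place.Completion v))) 1
        (galoisCohomology.res (homGaloisModule (toDGM X) (units K)) (Place.Completion v) 1 y) = 0) :
    galoisCohomology.map (postcomp (toDGM X) (units K) (toDGM (ideleBarD K)) (unitsToIdeleI K)) 1 y = 0 := by
  -- the cover `S : 0 → X₂ → ℤ[Γ/U_E]ᵏ → X → 0`
  haveI := moduleFinite_coverComplex_X₁ E X hX
  haveI := moduleFinite_coverComplex_X₂ E X
  haveI := moduleFinite_coverComplex_X₃ E X
  let S := coverComplex E X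
  have hS : S.ShortExact := coverComplex_shortExact E X hX
  -- `y = δ₀ w`, `w = ι ∘ u₀`
  obtain ⟨w, hw⟩ := dualδ₀_surjective (toDGM S.X₁) (toDGM S.X₂) (toDGM S.X₃) (units K) (lmap S.X₁ S.X₂ S.f)
    (lmap S.X₂ S.X₃ S.g) (isSES_toDGM hS) (baer_unitsCarrier K) (galoisCohomology_hom_units_cover_eq_zero E X) y
  set u₀ : S.X₁ ⟶ unitsBarD K := unitsHomOfInvariant S.X₁ w with hu₀
  have hwu : w = unitsInvariant S.X₁ u₀ := (unitsInvariant_unitsHomOfInvariant S.X₁ w).symm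
  rw [← hw, hwu]
  rw [← hw, hwu] at hloc
  -- local triviality ⟹ `ι_v ∘ u₀` extends locally ⟹ `u₀ ≫ (F̄ˣ → J̄)` extends globally
  obtain ⟨e, he⟩ := exists_comp_eq_unitsToIdele_of_localExtensions E S.f (coverComplex_X₁_trivial E X hX)
    (coverComplex_X₂_trivial E X) u₀ fun v => by
      have h0 : galoisCohomology.map (postcompRes (toDGM S.X₃) (units K) (units (Place.Completion v))
          (unitsTransfer K (Place.Completion v))) 1
          (galoisCohomology.res (homGaloisModule (toDGM S.X₃) (units K)) (Place.Completion v) 1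
            (dualδ₀ (toDGM S.X₁) (toDGM S.X₂) (toDGM S.X₃) (units K) (lmap S.X₁ S.X₂ S.f) (lmap S.X₂ S.X₃ S.g)
              (isSES_toDGM hS) (baer_unitsCarrier K) (unitsInvariant S.X₁ u₀))) = 0 := hloc v
      rw [map_res_dualδ₀_eq (toDGM S.X₁) (toDGM S.X₂) (toDGM S.X₃) (units K) (units (Place.Completion v))
        (unitsTransfer K (Place.Completion v)) (lmap S.X₁ S.X₂ S.f) (lmap S.X₂ S.X₃ S.g) (isSES_toDGM hS)
        (baer_unitsCarrier K) (baer_unitsCarrier (Place.Completion v)) (unitsInvariant S.X₁ u₀)] at h0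
      obtain ⟨q, hq⟩ := (dualδ₀_eq_zero_iff _ _ _ _ _ _ _ _ _).1 h0
      exact ⟨q, hq.symm⟩
  -- hence `H¹(j_*)(δ₀ (ι ∘ u₀))` is a coboundary
  refine map_postcomp_dualδ₀_eq_zero_of_extends' (toDGM S.X₁) (toDGM S.X₂) (toDGM S.X₃) (units K) (toDGM (ideleBarD K))
    (lmap S.X₁ S.X₂ S.f) (lmap S.X₂ S.X₃ S.g) (isSES_toDGM hS) (baer_unitsCarrier K) (unitsToIdeleI K)
    (unitsInvariant S.X₁ u₀) (homInvariant S.X₂ (ideleBarD K) e) fun x => ?_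
  have hex : e.hom.hom (S.f.hom.hom (LCarrier.val S.X₁ x)) = (unitsToIdele K).limitMap (u₀.hom.hom (LCarrier.val S.X₁ x)) := by
    have h1 := congrArg (fun φ : S.X₁ ⟶ ideleBarD K => φ.hom.hom (LCarrier.val S.X₁ x)) he
    exact h1
  rw [coe_homInvariant_apply, lmap_apply, LCarrier.val_of, hex, unitsToIdeleI_apply, coe_unitsInvariant, unitsMap_apply,
    AddEquiv.symm_apply_apply]

/-- **Consequence for the relation lattice `N₁` of the canonical presentation of a finite module** (covariant exactness of
chl-p2 g7's `Hom(N₁, T)`, `IsSES.exists_δ₀_eq_of_map_one_eq_zero`): a locally trivial `y ∈ H¹(K, Hom_ℤ(N₁, K̄ˣ))` is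
`δ₀^{Hom(N₁,T)}` of a `C_Γ`-morphism `h : N₁ ⟶ C̄` — the input "(B)" of property (e) for the native obstruction map
`shaTwoConnecting`. [cite: MilneADT2006, I Theorem 4.10 (proof, p. 58)] [cite: NeukirchSchmidtWingberg2008, (1.3.2)] -/
theorem exists_hom_δ₀_eq_of_locallyTrivial {M : Type} [AddCommGroup M] [TopologicalSpace M] [DiscreteTopology M] [Finite M]
    (ρ : DiscreteGaloisModule K M)
    (y : haveI := moduleFinite_presModule₁ ρ
      galoisCohomology (homGaloisModule (presModule₁ ρ) (units K)) 1)
    (hloc : haveI := moduleFinite_presModule₁ ρ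
      ∀ v : Place K,
      galoisCohomology.map (postcompRes (presModule₁ ρ) (units K) (units (Place.Completion v))
          (unitsTransfer K (Place.Completion v))) 1
        (galoisCohomology.res (homGaloisModule (presModule₁ ρ) (units K)) (Place.Completion v) 1 y) = 0) :
    ∃ h : (presentationComplex ρ).X₁ ⟶ classBarD K,
      (hom_idele_isSES ρ).δ₀ (haveI := moduleFinite_presModule₁ ρ; homInvariant (presentationComplex ρ).X₁ (classBarD K) h) = y := by
  haveI := moduleFinite_presModule₁ ρ
  have h0 : cohomologyMap (homF (presModule₁ ρ) (units K) (toDGM (ideleBarD K)) (unitsToIdeleI K)) 1 y = 0 :=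
    map_postcomp_unitsToIdeleI_eq_zero_of_locallyTrivial (presentationLayer ρ) (presentationComplex ρ).X₁
      (presentationComplex_X₁_trivial ρ) y hloc
  obtain ⟨v, hv⟩ := (hom_idele_isSES ρ).exists_δ₀_eq_of_map_one_eq_zero y h0
  refine ⟨homOfEquivariant (presentationComplex ρ).X₁ (classBarD K)
    (show LCarrier (presentationComplex ρ).X₁ →ₗ[ℤ] LCarrier (classBarD K) from
      (v.1 : DiscreteRep.HomCarrier (LCarrier (presentationComplex ρ).X₁) (LCarrier (classBarD K)))).toAddMonoidHom
    ((mem_invariants_iff (presModule₁ ρ) (toDGM (classBarD K)) v.1).1 v.2), ?_⟩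
  have hinv : homInvariant (presentationComplex ρ).X₁ (classBarD K) (homOfEquivariant (presentationComplex ρ).X₁ (classBarD K)
      (show LCarrier (presentationComplex ρ).X₁ →ₗ[ℤ] LCarrier (classBarD K) from
        (v.1 : DiscreteRep.HomCarrier (LCarrier (presentationComplex ρ).X₁) (LCarrier (classBarD K)))).toAddMonoidHom
      ((mem_invariants_iff (presModule₁ ρ) (toDGM (classBarD K)) v.1).1 v.2)) = v :=
    Subtype.ext (LinearMap.ext fun x => rfl)
  rw [hinv, hv]

/-- **(B) DISCHARGED, in the exact shape of hypothesis `hB` of chl-p2 g7's `HomDual.exists_shaTwoConnecting_eq_of_localGlobal`**: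
every `y ∈ H¹(K, Hom_ℤ(N₁, K̄ˣ))` whose transfer `H¹(res_v, ι_v ∘ –) y` vanishes at every place dies under
`H¹(j_*) : H¹(K, Hom_ℤ(N₁, K̄ˣ)) → H¹(K, Hom_ℤ(N₁, J̄))` (Milne I Lemma 4.13 in degree one for the relation lattice).
[cite: MilneADT2006, I Lemma 4.13, I Theorem 4.10 (proof, p. 58)] -/
theorem sha_hom_units_dies_in_idele {M : Type} [AddCommGroup M] [TopologicalSpace M] [DiscreteTopology M] [Finite M]
    (ρ : DiscreteGaloisModule K M) :
    haveI := moduleFinite_presModule₁ ρ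
    ∀ y : galoisCohomology (homGaloisModule (presModule₁ ρ) (units K)) 1,
      (∀ v : Place K, ContinuousCohomology.map (absGaloisRestrict K (Place.Completion v))
        (postcompResHom (presModule₁ ρ) (units K) (units (Place.Completion v)) (unitsTransfer K (Place.Completion v))) 1 y = 0) →
      cohomologyMap (homF (presModule₁ ρ) (units K) (toDGM (ideleBarD K)) (unitsToIdeleI K)) 1 y = 0 := by
  haveI := moduleFinite_presModule₁ ρ
  intro y hy
  exact map_postcomp_unitsToIdeleI_eq_zero_of_locallyTrivial (presentationLayer ρ) (presentationComplex ρ).X₁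
    (presentationComplex_X₁_trivial ρ) y (fun v => by rw [← map_postcompResHom_eq]; exact hy v)

/-- **Property (e) of the native obstruction map from (A) ALONE**: `Ш²(K, M^D) ⊆ Im (shaTwoConnecting ρ n hM)` as soon as
the local–global principle (A) holds for `H²(K, Hom_ℤ(ℤ[Γ/U_{K(M)}]^{|M|}, K̄ˣ))` on `Ш²`-classes (Brauer–Hasse–Noether for
`K(M)` + Shapiro; chl-p2 g7's displayed hypothesis `hA`) — hypothesis `hB` of `exists_shaTwoConnecting_eq_of_localGlobal` being
`sha_hom_units_dies_in_idele`.  HONEST FRAMING: (A) is NOT proved here; no case of Poitou–Tate or BSD is proved here.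
[cite: MilneADT2006, I Theorem 4.10 (a) (proof, p. 58), Lemma 4.13] -/
theorem exists_shaTwoConnecting_eq_of_localGlobalTwo {M : Type} [AddCommGroup M] [TopologicalSpace M] [DiscreteTopology M]
    [Finite M] (ρ : DiscreteGaloisModule K M) (n : ℕ) [NeZero n] (hM : ∀ m : M, n • m = 0)
    (hA : haveI := moduleFinite_presModule₂ ρ
      ∀ c ∈ shaTwo (ρ.tateDual n),
        cohomologyMap (dualF (presModule₂ ρ) ρ (units K) (presProj ρ)) 2 (cohomologyMap (tateDualUnitsIso K ρ n hM).hom 2 c) = 0)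
    (c : galoisCohomology (ρ.tateDual n) 2) (hc : c ∈ shaTwo (ρ.tateDual n)) :
    ∃ h : (presentationComplex ρ).X₁ ⟶ classBarD K, shaTwoConnecting ρ n hM h = c :=
  exists_shaTwoConnecting_eq_of_localGlobal ρ n hM hA (sha_hom_units_dies_in_idele ρ) c hc

end Main

end IdeleReadout

end Literature.NumberTheory.GaloisRepresentations

end
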